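import Summits.Ventures.PercRepro.C025ProfilePLDFiveLiftTen
import Summits.Ventures.PercRepro.C025ProfilePLDSevenLiftFiveCorollaries

/-!
# THE RANK-5 UNIFORM SUMMAND AT RANK ≤ 10: (PLD)-MATROIDS OF RANK ≤ 10 ⊕ U_{5,m}, «RANK ≤ 3 ⊕ U_{7,m′} ⊕ U_{5,m}» (night-3 g35)

`proofs/NIGHT3-G35-BASEMAP.md` §2.  With `PLDFiveLift.pld_disjointSum_uniform_five_ge_9_of_eRank_le_10` — (PLD)(M) ∧ rank M ≤ 10
⟹ (PLD)(M ⊕ U_{5,m}) for every `m ≥ 9` (the rank-10 preservers are those of rank 8: q₅″ = T₃₅ + 3·T₄₅, `lift_instance_five_eight`)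
— and the landed rank-3 base for the rank-7 uniform summand (g33): (PLD), hence C-025 at every `(p, q)` on every truncation of
`N ⊕ free points`, for `N` = «any (PLD)-matroid of rank ≤ 10 ⊕ U_{5,m} with m ≥ 9» and «any matroid of rank ≤ 3 ⊕ U_{7,m′} with
m′ ≥ 13 ⊕ U_{5,m} with m ≥ 9» (rank exactly 10 before the lift).  No `def`, no `instance`, no notation.  Axioms: standard.
-/

open scoped Matroid

namespace PercRepro

open Finset ThmH

namespace PLDFiveLift

variable {α : Type} [DecidableEq α]

/-- C-025 AT EVERY `(p, q)` ON EVERY TRUNCATION OF «(PLD)-MATROID OF RANK ≤ 10 ⊕ U_{5,m} WITH m ≥ 9 ⊕ FREE POINTS». -/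
theorem rls_truncate_disjointSum_five_freeOn_of_pld_ten (M : Matroid α) [M.Finite] (hr : M.eRank ≤ 10)
    (hPLD : ∀ lo hi δ Θ : ℕ, Θ ≤ lo + hi + δ → (lo = 0 ∨ lo + hi + δ ≤ Θ) →
      (∑ I ∈ (gr M).powerset, (if lo ≤ (M.eRk (I : Set α)).toNat ∧ (M.eRk (I : Set α)).toNat ≤ hi ∧
          Θ ≤ (M.eRk ((gr M \ I : Finset α) : Set α)).toNat + (M.eRk (I : Set α)).toNat then
          ((M.eRk ((gr M \ I : Finset α) : Set α)).toNat).choose δ else 0)) ≤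
        ∑ I ∈ (gr M).powerset, (if lo + δ ≤ (M.eRk ((gr M \ I : Finset α) : Set α)).toNat ∧
          (M.eRk ((gr M \ I : Finset α) : Set α)).toNat ≤ hi + δ then
          ((M.eRk ((gr M \ I : Finset α) : Set α)).toNat).choose δ else 0))
    (F : Finset α) (hF : 9 ≤ F.card) (h : Disjoint M.E (@Matroid.truncate α (Matroid.freeOn (F : Set α)) (PLDTruncate.freeOn_finite' F) 5).E)
    (E₃ : Finset α) (h₃ : Disjoint (M.disjointSum (@Matroid.truncate α (Matroid.freeOn (F : Set α)) (PLDTruncate.freeOn_finite' F) 5) h).E (E₃ : Set α)) (r p q : ℕ) :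
    haveI := PLDTruncate.freeOn_finite' F
    haveI := PLDClosure.disjointSum_finite' _ _ h
    haveI := PLDBridge.disjointSum_freeOn_finite _ E₃ h₃
    ThmN.RLS (PercRepro.Matroid.truncate ((M.disjointSum (@Matroid.truncate α (Matroid.freeOn (F : Set α)) (PLDTruncate.freeOn_finite' F) 5) h).disjointSum (Matroid.freeOn (E₃ : Set α)) h₃) r) p q := by
  haveI := PLDTruncate.freeOn_finite' F
  haveI := PLDClosure.disjointSum_finite' _ _ h
  exact PLDBridge.rls_disjointSum_freeOn_of_pld _ E₃ h₃ r p q (pld_disjointSum_uniform_five_ge_9_of_eRank_le_10 M hr hPLD F hF h)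

/-- (PLD) FOR «RANK ≤ 3 ⊕ U_{7,m′} WITH m′ ≥ 13 ⊕ U_{5,m} WITH m ≥ 9» (unconditional; the rank-7 summand first, then the rank-5 summand at rank ≤ 10). -/
theorem pld_disjointSum_seven_five_of_eRank_le_three (M : Matroid α) [M.Finite] (h3 : M.eRank ≤ 3)
    (F₁ : Finset α) (hF₁ : 13 ≤ F₁.card) (h₁ : Disjoint M.E (@Matroid.truncate α (Matroid.freeOn (F₁ : Set α)) (PLDTruncate.freeOn_finite' F₁) 7).E)
    (F₂ : Finset α) (hF₂ : 9 ≤ F₂.card)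
    (h₂ : Disjoint (M.disjointSum (@Matroid.truncate α (Matroid.freeOn (F₁ : Set α)) (PLDTruncate.freeOn_finite' F₁) 7) h₁).E (@Matroid.truncate α (Matroid.freeOn (F₂ : Set α)) (PLDTruncate.freeOn_finite' F₂) 5).E) :
    haveI := PLDTruncate.freeOn_finite' F₁
    haveI := PLDTruncate.freeOn_finite' F₂
    haveI := PLDClosure.disjointSum_finite' _ _ h₁
    haveI := PLDClosure.disjointSum_finite' _ _ h₂
    ∀ lo hi δ Θ : ℕ, Θ ≤ lo + hi + δ → (lo = 0 ∨ lo + hi + δ ≤ Θ) →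
      (∑ I ∈ (gr ((M.disjointSum (@Matroid.truncate α (Matroid.freeOn (F₁ : Set α)) (PLDTruncate.freeOn_finite' F₁) 7) h₁).disjointSum (@Matroid.truncate α (Matroid.freeOn (F₂ : Set α)) (PLDTruncate.freeOn_finite' F₂) 5) h₂)).powerset, (if lo ≤ (((M.disjointSum (@Matroid.truncate α (Matroid.freeOn (F₁ : Set α)) (PLDTruncate.freeOn_finite' F₁) 7) h₁).disjointSum (@Matroid.truncate α (Matroid.freeOn (F₂ : Set α)) (PLDTruncate.freeOn_finite' F₂) 5) h₂).eRk (I : Set α)).toNat ∧ (((M.disjointSum (@Matroid.truncate α (Matroid.freeOn (F₁ : Set α)) (PLDTruncate.freeOn_finite' F₁) 7) h₁).disjointSum (@Matroid.truncate α (Matroid.freeOn (F₂ : Set α)) (PLDTruncate.freeOn_finite' F₂) 5) h₂).eRk (I : Set α)).toNat ≤ hi ∧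
          Θ ≤ (((M.disjointSum (@Matroid.truncate α (Matroid.freeOn (F₁ : Set α)) (PLDTruncate.freeOn_finite' F₁) 7) h₁).disjointSum (@Matroid.truncate α (Matroid.freeOn (F₂ : Set α)) (PLDTruncate.freeOn_finite' F₂) 5) h₂).eRk ((gr ((M.disjointSum (@Matroid.truncate α (Matroid.freeOn (F₁ : Set α)) (PLDTruncate.freeOn_finite' F₁) 7) h₁).disjointSum (@Matroid.truncate α (Matroid.freeOn (F₂ : Set α)) (PLDTruncate.freeOn_finite' F₂) 5) h₂) \ I : Finset α) : Set α)).toNat + (((M.disjointSum (@Matroid.truncate α (Matroid.freeOn (F₁ : Set α)) (PLDTruncate.freeOn_finite' F₁) 7) h₁).disjointSum (@Matroid.truncate α (Matroid.freeOn (F₂ : Set α)) (PLDTruncate.freeOn_finite' F₂) 5) h₂).eRk (I : Set α)).toNat then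
          ((((M.disjointSum (@Matroid.truncate α (Matroid.freeOn (F₁ : Set α)) (PLDTruncate.freeOn_finite' F₁) 7) h₁).disjointSum (@Matroid.truncate α (Matroid.freeOn (F₂ : Set α)) (PLDTruncate.freeOn_finite' F₂) 5) h₂).eRk ((gr ((M.disjointSum (@Matroid.truncate α (Matroid.freeOn (F₁ : Set α)) (PLDTruncate.freeOn_finite' F₁) 7) h₁).disjointSum (@Matroid.truncate α (Matroid.freeOn (F₂ : Set α)) (PLDTruncate.freeOn_finite' F₂) 5) h₂) \ I : Finset α) : Set α)).toNat).choose δ else 0)) ≤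
        ∑ I ∈ (gr ((M.disjointSum (@Matroid.truncate α (Matroid.freeOn (F₁ : Set α)) (PLDTruncate.freeOn_finite' F₁) 7) h₁).disjointSum (@Matroid.truncate α (Matroid.freeOn (F₂ : Set α)) (PLDTruncate.freeOn_finite' F₂) 5) h₂)).powerset, (if lo + δ ≤ (((M.disjointSum (@Matroid.truncate α (Matroid.freeOn (F₁ : Set α)) (PLDTruncate.freeOn_finite' F₁) 7) h₁).disjointSum (@Matroid.truncate α (Matroid.freeOn (F₂ : Set α)) (PLDTruncate.freeOn_finite' F₂) 5) h₂).eRk ((gr ((M.disjointSum (@Matroid.truncate α (Matroid.freeOn (F₁ : Set α)) (PLDTruncate.freeOn_finite' F₁) 7) h₁).disjointSum (@Matroid.truncate α (Matroid.freeOn (F₂ : Set α)) (PLDTruncate.freeOn_finite' F₂) 5) h₂) \ I : Finset α) : Set α)).toNat ∧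
          (((M.disjointSum (@Matroid.truncate α (Matroid.freeOn (F₁ : Set α)) (PLDTruncate.freeOn_finite' F₁) 7) h₁).disjointSum (@Matroid.truncate α (Matroid.freeOn (F₂ : Set α)) (PLDTruncate.freeOn_finite' F₂) 5) h₂).eRk ((gr ((M.disjointSum (@Matroid.truncate α (Matroid.freeOn (F₁ : Set α)) (PLDTruncate.freeOn_finite' F₁) 7) h₁).disjointSum (@Matroid.truncate α (Matroid.freeOn (F₂ : Set α)) (PLDTruncate.freeOn_finite' F₂) 5) h₂) \ I : Finset α) : Set α)).toNat ≤ hi + δ then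
          ((((M.disjointSum (@Matroid.truncate α (Matroid.freeOn (F₁ : Set α)) (PLDTruncate.freeOn_finite' F₁) 7) h₁).disjointSum (@Matroid.truncate α (Matroid.freeOn (F₂ : Set α)) (PLDTruncate.freeOn_finite' F₂) 5) h₂).eRk ((gr ((M.disjointSum (@Matroid.truncate α (Matroid.freeOn (F₁ : Set α)) (PLDTruncate.freeOn_finite' F₁) 7) h₁).disjointSum (@Matroid.truncate α (Matroid.freeOn (F₂ : Set α)) (PLDTruncate.freeOn_finite' F₂) 5) h₂) \ I : Finset α) : Set α)).toNat).choose δ else 0) := by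
  haveI := PLDTruncate.freeOn_finite' F₁
  haveI := PLDTruncate.freeOn_finite' F₂
  haveI := PLDClosure.disjointSum_finite' _ _ h₁
  have h1 := PLDSevenLift.pld_disjointSum_seven_of_eRank_le_three M h3 F₁ hF₁ h₁
  have hr1 : (M.disjointSum (@Matroid.truncate α (Matroid.freeOn (F₁ : Set α)) (PLDTruncate.freeOn_finite' F₁) 7) h₁).eRank ≤ 10 := by
    rw [PLDTwoLiftGen.eRank_disjointSum]
    calc M.eRank + (@Matroid.truncate α (Matroid.freeOn (F₁ : Set α)) (PLDTruncate.freeOn_finite' F₁) 7).eRank ≤ 3 + 7 := add_le_add h3 (PLDSevenLift.eRank_seven_le F₁)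
      _ ≤ 10 := by norm_num
  exact pld_disjointSum_uniform_five_ge_9_of_eRank_le_10 _ hr1 h1 F₂ hF₂ h₂

/-- C-025 AT EVERY `(p, q)` ON EVERY TRUNCATION OF «RANK ≤ 3 ⊕ U_{7,m′} WITH m′ ≥ 13 ⊕ U_{5,m} WITH m ≥ 9 ⊕ FREE POINTS». -/
theorem rls_truncate_disjointSum_seven_five_freeOn_of_eRank_le_three (M : Matroid α) [M.Finite] (h3 : M.eRank ≤ 3)
    (F₁ : Finset α) (hF₁ : 13 ≤ F₁.card) (h₁ : Disjoint M.E (@Matroid.truncate α (Matroid.freeOn (F₁ : Set α)) (PLDTruncate.freeOn_finite' F₁) 7).E)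
    (F₂ : Finset α) (hF₂ : 9 ≤ F₂.card)
    (h₂ : Disjoint (M.disjointSum (@Matroid.truncate α (Matroid.freeOn (F₁ : Set α)) (PLDTruncate.freeOn_finite' F₁) 7) h₁).E (@Matroid.truncate α (Matroid.freeOn (F₂ : Set α)) (PLDTruncate.freeOn_finite' F₂) 5).E)
    (E₃ : Finset α) (h₃ : Disjoint ((M.disjointSum (@Matroid.truncate α (Matroid.freeOn (F₁ : Set α)) (PLDTruncate.freeOn_finite' F₁) 7) h₁).disjointSum (@Matroid.truncate α (Matroid.freeOn (F₂ : Set α)) (PLDTruncate.freeOn_finite' F₂) 5) h₂).E (E₃ : Set α)) (r p q : ℕ) :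
    haveI := PLDTruncate.freeOn_finite' F₁
    haveI := PLDTruncate.freeOn_finite' F₂
    haveI := PLDClosure.disjointSum_finite' _ _ h₁
    haveI := PLDClosure.disjointSum_finite' _ _ h₂
    haveI := PLDBridge.disjointSum_freeOn_finite _ E₃ h₃
    ThmN.RLS (PercRepro.Matroid.truncate (((M.disjointSum (@Matroid.truncate α (Matroid.freeOn (F₁ : Set α)) (PLDTruncate.freeOn_finite' F₁) 7) h₁).disjointSum (@Matroid.truncate α (Matroid.freeOn (F₂ : Set α)) (PLDTruncate.freeOn_finite' F₂) 5) h₂).disjointSum (Matroid.freeOn (E₃ : Set α)) h₃) r) p q := by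
  haveI := PLDTruncate.freeOn_finite' F₁
  haveI := PLDTruncate.freeOn_finite' F₂
  haveI := PLDClosure.disjointSum_finite' _ _ h₁
  haveI := PLDClosure.disjointSum_finite' _ _ h₂
  exact PLDBridge.rls_disjointSum_freeOn_of_pld _ E₃ h₃ r p q
    (pld_disjointSum_seven_five_of_eRank_le_three M h3 F₁ hF₁ h₁ F₂ hF₂ h₂)
end PLDFiveLift

end PercRepro
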